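import Mathlib
import Literature.Dynamics.Hamiltonian.KaloshinZhang2020.CuspSlices

/-!
# The slice argument yields RESIDUAL, not OPEN-DENSE, direction sets: a kernel-checked counterexample

CITATION HEADER (lean-in-tree rule 2026-08-18). Companion of
`Literature.Dynamics.Hamiltonian.KaloshinZhang2020.CuspSlices` (L-gen-1), written by the pub-arnold near-miss
cell (referee/literature seat) to type one precise point of the comparison of genericity classes in print for
Arnold diffusion in nearly integrable systems:
* Cheng–Xue, *Arnold diffusion for nearly integrable Hamiltonian systems*, Sci. China Math. 66 (2023) (bib key
  `ChengXue2023`; audited in the last arXiv text, arXiv:1503.04153v5, 2019-05-08): the definition of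
  "cusp-residual" in v5 (§1, TeX l. 208) reads "Let ℜ_a be a set OPEN-DENSE in 𝔖_a, each P ∈ ℜ_a is associated
  with a set R_P residual in the interval [0, a_P] with a_P ≤ a", and the final assembly (l. 2187) reads
  "applying Karatowski-Ulam Theorem [Oxtoby, Thm 15.1; v5 l. 1402–1404] … we get that there exists an
  open-dense set ℜ ⊂ 𝔖₁ such that for each P ∈ ℜ there exist ε_P and a residual set R_P ⊂ (0, ε_P)".
  The EARLIER arXiv text (2015; corpus `paper:arxiv-1503.04153` p0004:L1, p0065:L25) and every published
  3-degrees-of-freedom paper of the first author (Cheng, Camb. J. Math. 5 (2017) p. 217; Cheng, Asian J. Math.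
  23 (2019), arXiv:1801.02921 l. 109) define ℜ_a as a RESIDUAL subset of 𝔖_a and conclude from Kuratowski–Ulam
  "a residual set ℜ on the unit sphere".
* Kaloshin–Zhang, Ann. of Math. Stud. 208 (2020), Thm 1.2 (bib key `KaloshinZhang2020`): the good set `𝒲` is
  open and dense in the cusp `𝒱(𝒰, ε₀)`.
WHAT IS PROVED HERE (point-set topology only, nothing about Hamiltonian systems): there is an open set `W ⊆ ℝ × ℝ`
(amplitude × direction), dense in the cusp `{0 < λ < 1}`, such that the set of directions whose amplitude fibre
is dense in `(0, 1)` is RESIDUAL (as L-gen-1 guarantees) but contains NO open dense set of directions — indeed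
no non-empty open set, since every rational direction `q` has its fibre cut away below a height `1/(encode q + 1)`
(`Wex`, `rat_not_good`, `no_openDense_good`). The second theorem `no_openDense_good_cx` states the same failure in
the exact quantifier format of the v5 definition (a direction-dependent `a_P ∈ (0, 1]` and a set `R_P` residual in
`[0, a_P]` are allowed). CONSEQUENCE recorded for the cell's comparison G8′: the abstract Kuratowski–Ulam / slice
argument (the ONLY argument the v5 text offers at l. 2187 for its open-dense ℜ) delivers the 2015/2017/2019
RESIDUAL form of the definition and cannot deliver the v5 OPEN-DENSE form; an open-dense set of directions needs
an additional openness argument (e.g. regularity of `P ↦ ε_P`), which the v5 text does not state (cell audit focus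
AF1′). Nothing here adjudicates the theorem itself — the counterexample is abstract and says only which
conclusion the cited tool supports. All declarations are kernel-checked and tagged [folklore].
-/

open Set Filter Encodable
open scoped Topology

namespace Literature.Dynamics.Hamiltonian.KaloshinZhang2020

/-- Height below which the amplitude fibre over the rational direction `q` is excised. [folklore] -/
noncomputable def badHeight (q : ℚ) : ℝ := 1 / ((encode q : ℝ) + 1)

/-- `badHeight q > 0`. [folklore] -/
theorem badHeight_pos (q : ℚ) : 0 < badHeight q := by
  unfold badHeight; positivity

/-- `badHeight q ≤ 1`. [folklore] -/
theorem badHeight_le_one (q : ℚ) : badHeight q ≤ 1 := by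
  unfold badHeight
  rw [div_le_one (by positivity)]
  linarith [(Nat.cast_nonneg (encode q) : (0 : ℝ) ≤ encode q)]

/-- The `N`-th cell: amplitudes above `1/(N+1)` and below `1`, directions avoiding the first `N` rationals in the
enumeration `encode`. Open. [folklore] -/
def Ucell (N : ℕ) : Set (ℝ × ℝ) :=
  {p | 1 / ((N : ℝ) + 1) < p.1 ∧ p.1 < 1 ∧ ∀ q : ℚ, encode q < N → p.2 ≠ (q : ℝ)}

/-- The counterexample set `W = ⋃_N Ucell N`: the cusp `{0 < λ < 1}` with, over each rational direction `q`, the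
segment of amplitudes `(0, 1/(encode q + 1)]` removed. [folklore] -/
def Wex : Set (ℝ × ℝ) := ⋃ N : ℕ, Ucell N

/-- Each cell is open: two open half-spaces and a FINITE intersection of complements of lines. [folklore] -/
theorem isOpen_Ucell (N : ℕ) : IsOpen (Ucell N) := by
  have h1 : IsOpen {p : ℝ × ℝ | 1 / ((N : ℝ) + 1) < p.1} :=
    isOpen_lt continuous_const continuous_fst
  have h2 : IsOpen {p : ℝ × ℝ | p.1 < 1} := isOpen_lt continuous_fst continuous_const
  have hfin : ({q : ℚ | encode q < N} : Set ℚ).Finite := by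
    have : {q : ℚ | encode q < N} ⊆ (encode : ℚ → ℕ) ⁻¹' (Finset.range N : Set ℕ) := by
      intro q hq; simpa using hq
    exact ((Finset.range N).finite_toSet.preimage (encode_injective.injOn)).subset this
  have h3 : IsOpen (⋂ q ∈ {q : ℚ | encode q < N}, {p : ℝ × ℝ | p.2 ≠ (q : ℝ)}) :=
    hfin.isOpen_biInter (fun q _ => isOpen_ne_fun continuous_snd continuous_const)
  have : Ucell N = {p : ℝ × ℝ | 1 / ((N : ℝ) + 1) < p.1} ∩ {p : ℝ × ℝ | p.1 < 1} ∩
      (⋂ q ∈ {q : ℚ | encode q < N}, {p : ℝ × ℝ | p.2 ≠ (q : ℝ)}) := by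
    ext p
    simp only [Ucell, mem_setOf_eq, mem_inter_iff, mem_iInter]
    tauto
  rw [this]
  exact (h1.inter h2).inter h3

/-- `Wex` is open (a union of open cells). [folklore] -/
theorem isOpen_Wex : IsOpen Wex := isOpen_iUnion isOpen_Ucell

/-- `Wex` lies in the cusp `{0 < λ < 1}` (height `a ≡ 1`). [folklore] -/
theorem Wex_subset_cusp : Wex ⊆ cuspSet (fun _ : ℝ => (1 : ℝ)) := by
  rintro ⟨l, P⟩ hp
  obtain ⟨N, hN⟩ := mem_iUnion.1 hp
  obtain ⟨h1, h2, -⟩ := hN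
  exact ⟨lt_trans (by positivity) h1, h2⟩

/-- Irrational directions keep their whole fibre. [folklore] -/
theorem mem_Wex_of_irrational {l P : ℝ} (h0 : 0 < l) (h1 : l < 1) (hP : Irrational P) : (l, P) ∈ Wex := by
  obtain ⟨N, hN⟩ := exists_nat_one_div_lt h0
  refine mem_iUnion.2 ⟨N, hN, h1, ?_⟩
  intro q _ hPq
  exact hP ⟨q, hPq.symm⟩

/-- `W` is dense in the cusp. [folklore] -/
theorem cusp_subset_closure_Wex : cuspSet (fun _ : ℝ => (1 : ℝ)) ⊆ closure Wex := by
  rintro ⟨l, P⟩ ⟨h0, h1⟩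
  rw [mem_closure_iff_nhds]
  intro U hU
  obtain ⟨V, hVU, hVopen, hlPV⟩ := mem_nhds_iff.1 hU
  obtain ⟨ε, hε, hball⟩ := Metric.isOpen_iff.1 hVopen (l, P) hlPV
  obtain ⟨P', hP', hlo, hhi⟩ := exists_irrational_btwn (show P < P + ε / 2 by linarith)
  refine ⟨(l, P'), hVU (hball ?_), mem_Wex_of_irrational h0 h1 hP'⟩
  rw [Metric.mem_ball, Prod.dist_eq, Real.dist_eq, Real.dist_eq, sub_self, abs_zero, max_lt_iff]
  refine ⟨hε, ?_⟩
  rw [abs_sub_lt_iff]; constructor <;> linarith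

/-- Over a rational direction `q`, no amplitude `≤ badHeight q` survives. [folklore] -/
theorem not_mem_Wex_rat {l : ℝ} (q : ℚ) (hl : l ≤ badHeight q) : (l, (q : ℝ)) ∉ Wex := by
  intro hp
  obtain ⟨N, hN⟩ := mem_iUnion.1 hp
  obtain ⟨h1, -, h3⟩ := hN
  have hNq : N ≤ encode q := by
    by_contra hlt
    exact h3 q (lt_of_not_ge hlt) rfl
  have : badHeight q ≤ 1 / ((N : ℝ) + 1) := by
    unfold badHeight
    apply one_div_le_one_div_of_le (by positivity)
    have : (N : ℝ) ≤ encode q := by exact_mod_cast hNq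
    linarith
  simp only at h1
  linarith

/-- A rational direction is NOT good: its fibre is not dense in `(0, 1)`. [folklore] -/
theorem rat_not_good (q : ℚ) :
    ¬ (Ioo (0 : ℝ) 1 ⊆ closure (slice Wex (q : ℝ) ∩ Ioo 0 1)) := by
  intro h
  have hsub : slice Wex (q : ℝ) ∩ Ioo 0 1 ⊆ Ici (badHeight q) := by
    rintro l ⟨hl, -⟩
    by_contra hlt
    exact not_mem_Wex_rat q (le_of_lt (lt_of_not_ge hlt)) hl
  have hcl : closure (slice Wex (q : ℝ) ∩ Ioo 0 1) ⊆ Ici (badHeight q) :=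
    closure_minimal hsub isClosed_Ici
  have hmem : badHeight q / 2 ∈ Ioo (0 : ℝ) 1 :=
    ⟨by linarith [badHeight_pos q], by linarith [badHeight_le_one q, badHeight_pos q]⟩
  have := hcl (h hmem)
  simp only [mem_Ici] at this
  linarith [badHeight_pos q]

/-- The good directions are residual (L-gen-1 applied to `Wex`). [folklore] -/
theorem residual_good_Wex :
    {P : ℝ | Ioo 0 ((fun _ : ℝ => (1 : ℝ)) P) ⊆ closure (slice Wex P ∩ Ioo 0 ((fun _ : ℝ => (1 : ℝ)) P))}
      ∈ residual ℝ :=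
  residual_setOf_slice_dense (fun _ : ℝ => (1 : ℝ)) Wex isOpen_Wex cusp_subset_closure_Wex

/-- …but NO open dense set of directions (indeed no non-empty open set) consists of good directions: every
non-empty open subset of `ℝ` contains a rational. [folklore] -/
theorem no_openDense_good :
    ¬ ∃ ℜ : Set ℝ, IsOpen ℜ ∧ Dense ℜ ∧
      ∀ P ∈ ℜ, Ioo (0 : ℝ) 1 ⊆ closure (slice Wex P ∩ Ioo 0 1) := by
  rintro ⟨ℜ, hopen, hdense, hgood⟩
  obtain ⟨x, hx⟩ := hdense.nonempty
  obtain ⟨ε, hε, hball⟩ := Metric.isOpen_iff.1 hopen x hx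
  obtain ⟨q, hq1, hq2⟩ := exists_rat_btwn (show x < x + ε / 2 by linarith)
  have hqℜ : (q : ℝ) ∈ ℜ := by
    apply hball
    rw [Metric.mem_ball, Real.dist_eq, abs_sub_lt_iff]
    constructor <;> linarith
  exact rat_not_good q (hgood _ hqℜ)

/-- The same failure in the exact quantifier format of the v5 definition of "cusp-residual" (direction-dependent
height `a_P ∈ (0, 1]`, `R_P` residual in `[0, a_P]`, good amplitudes `t ∈ R_P`): no open dense set of directions
can be served by `Wex`, because a residual subset of `[0, a_P]` is dense there and so reaches below
`badHeight q` over a rational `q`. [folklore] -/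
theorem no_openDense_good_cx :
    ¬ ∃ ℜ : Set ℝ, IsOpen ℜ ∧ Dense ℜ ∧
      ∀ P ∈ ℜ, ∃ aP : ℝ, 0 < aP ∧ aP ≤ 1 ∧
        ∃ R : Set ℝ, R ⊆ Icc 0 aP ∧
          (Subtype.val ⁻¹' R : Set (Icc (0 : ℝ) aP)) ∈ residual (Icc (0 : ℝ) aP) ∧
          ∀ t ∈ R, (t, P) ∈ Wex := by
  rintro ⟨ℜ, hopen, hdense, hgood⟩
  obtain ⟨x, hx⟩ := hdense.nonempty
  obtain ⟨ε, hε, hball⟩ := Metric.isOpen_iff.1 hopen x hx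
  obtain ⟨q, hq1, hq2⟩ := exists_rat_btwn (show x < x + ε / 2 by linarith)
  have hqℜ : (q : ℝ) ∈ ℜ := by
    apply hball
    rw [Metric.mem_ball, Real.dist_eq, abs_sub_lt_iff]
    constructor <;> linarith
  obtain ⟨aP, haP, -, R, hRsub, hRres, hRgood⟩ := hgood _ hqℜ
  -- the residual set is dense in the Baire space `Icc 0 aP`
  have hRdense : Dense (Subtype.val ⁻¹' R : Set (Icc (0 : ℝ) aP)) := dense_of_mem_residual hRres
  -- the open set of the subtype below `min aP (badHeight q)`
  set c : ℝ := min aP (badHeight q) with hc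
  have hc0 : 0 < c := lt_min haP (badHeight_pos q)
  have hU : IsOpen {t : Icc (0 : ℝ) aP | (t : ℝ) < c} :=
    isOpen_lt continuous_subtype_val continuous_const
  have hUne : ({t : Icc (0 : ℝ) aP | (t : ℝ) < c} : Set (Icc (0 : ℝ) aP)).Nonempty :=
    ⟨⟨0, le_refl 0, le_of_lt haP⟩, hc0⟩
  obtain ⟨⟨t, ht0, htaP⟩, htR, htc⟩ := hRdense.exists_mem_open hU hUne
  have htc' : t < c := htc
  have htbad : t ≤ badHeight q := le_of_lt (lt_of_lt_of_le htc' (min_le_right _ _))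
  exact not_mem_Wex_rat q htbad (hRgood t htR)

end Literature.Dynamics.Hamiltonian.KaloshinZhang2020
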